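import Summits.Ventures.PercRepro.C041ZoneOCubeUnionPi

/-!
# The UNION LEMMA for a family of components indexed by any finite type (p6, gen 27; C-041.md §14 (c)–(d))

Setting of `C041ZoneOCubeUnionPi`.  The `n`-component lemma transported along `Fintype.equivFin ι` and
`Equiv.piCongrLeft'`: for any finite index type `ι` (the indexed zones of a skeleton), if every component `S i` has
`G_t ⇒ valid` and a nonnegative weighted sum, the product `∀ i, S i` with the disjunctions has a nonnegative weighted
sum (`union_lemma_fintype`).
-/

namespace PercRepro

namespace ZoneOCube

open Finset

/-- The weight on a product over any index type. -/
noncomputable def ocwPi' {ι : Type*} {S : ι → Type*} (v g h : ∀ i, S i → Prop) (σ : ∀ i, S i) : ℤ :=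
  ocw (fun σ : ∀ i, S i => ∃ i, v i (σ i)) (fun σ => ∃ i, g i (σ i)) (fun σ => ∃ i, h i (σ i)) σ

/-- A predicate `∃ i, p i (σ i)` transported along a bijection of the index type. -/
theorem exists_piCongrLeft'_iff {ι : Type*} {S : ι → Type*} {n : ℕ} (p : ∀ i, S i → Prop) (e : ι ≃ Fin n)
    (σ : ∀ i, S i) : (∃ j, p (e.symm j) ((Equiv.piCongrLeft' S e) σ j)) ↔ ∃ i, p i (σ i) := by
  constructor
  · rintro ⟨j, hj⟩
    exact ⟨e.symm j, hj⟩
  · rintro ⟨i, hi⟩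
    refine ⟨e i, ?_⟩
    change p (e.symm (e i)) (σ (e.symm (e i)))
    rw [Equiv.symm_apply_apply]
    exact hi

/-- **THE UNION LEMMA FOR ANY FINITE FAMILY OF COMPONENTS.** -/
theorem union_lemma_fintype {ι : Type*} [Fintype ι] [DecidableEq ι] {S : ι → Type*} [∀ i, Fintype (S i)] (v g h : ∀ i, S i → Prop)
    (hg : ∀ i σ, g i σ → v i σ) (hh : ∀ i σ, h i σ → v i σ) (H : ∀ i, 0 ≤ ∑ σ, ocw (v i) (g i) (h i) σ) :
    0 ≤ ∑ σ : ∀ i, S i, ocwPi' v g h σ := by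
  set e := Fintype.equivFin ι
  have key := union_lemma_pi (S := fun j => S (e.symm j)) (fun j => v (e.symm j)) (fun j => g (e.symm j))
    (fun j => h (e.symm j)) (fun j σ => hg _ σ) (fun j σ => hh _ σ) (fun j => H (e.symm j))
  rw [← Fintype.sum_equiv (Equiv.piCongrLeft' S e) (ocwPi' v g h)
    (ocwPi (fun j => v (e.symm j)) (fun j => g (e.symm j)) (fun j => h (e.symm j))) fun σ => ?_] at key
  · exact key
  · unfold ocwPi' ocwPi
    exact ocw_eq_of_iff (exists_piCongrLeft'_iff v e σ).symm (exists_piCongrLeft'_iff g e σ).symm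
      (exists_piCongrLeft'_iff h e σ).symm

end ZoneOCube

end PercRepro
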